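import Literature.MathematicalPhysics.QuantumFieldTheory.Balaban1983to89.B7Prop3GeneralLinear
import Literature.MathematicalPhysics.QuantumFieldTheory.Balaban1983to89.B12AverageCorridor267

/-!
# Bałaban's renormalization group for 4-d lattice Yang–Mills — B7 Proposition 3 AT A GENERAL BACKGROUND `V₀`, the LINEAR
PART, file 2: the derivative of `Ṽ₁(c)` along `V₁ = e^{tA}` — (113)–(119), print's `(Q′(V₀)A)_c` — and the linear part
«L(Q(V₀)A)_c» of (122) IN CLOSED FORM (120), with its ADDITIVITY and HOMOGENEITY in `A` ("its Taylor expansion begins with a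
first-order polynomial") as theorems (`B7Prop3GeneralTild`)

CITATION HEADER (lean-in-tree rule 2026-08-18).  Audit cell `pub-balaban`, sub-cell `t4` (NE7c ROUND-2 crew, seat
`b2b-balaban-t4-ne7c-formalise-leaf-05` gen 6; owner table `t4/b2b-balaban-t4-ne7c-p1/LEAVES-NE7c-P1.md` v2.3 row S55
«[B7] PROPOSITION 3 AT A GENERAL REGULAR BACKGROUND», WALL §2 (a) item `Cf`; files 1–2 of the row: `B7Prop3GeneralRotated`
(p219571), `B7Prop3GeneralLinear`).  Source: T. Bałaban, *Averaging operations for lattice gauge theories*, Commun. Math.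
Phys. **98**, 17–51 (1985) [Balaban1985Averaging] (cell paper B7; journal page = PDF page + 16), Sect. D pp. 34–36
[PDF 18–20] ((113)–(122)), quoted from the page renders `b2b-balaban-ref1/pages/1985-cmp98-averaging/1985-cmp98-averaging-p018-x2.png`,
`-p019-x2.png`, `-p020-x2.png` READ AS IMAGES by this seat (2026-08-20); (38) p. 22 through the b07 lineage's
`B7Eq38Remainder` header.
Companions (REUSED BY NAME, none modified): `B7Prop3GeneralRotated`/`B7Prop3GeneralLinear` (this seat: `tsum` =
`(R_{0,y}A)(Γ)`, `hasDerivAt_hol_expCfg_mul`, `hasDerivAt_tHol_expCfg`, `FhatCov`, `Qcov`/`linQcov`,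
`hasDerivAt_Qcov_of_tild`), `B7Eq92Concrete` (`tild` (65) = `Ṽ₁`, `tHol` (58)), `B7Prop1Explicit` (`Wcx` = the loop
`V(Γ_{c,x}∪(−c))` of (42), `Xavg` = its exponent `X_c`, `bavg`, `gammaWord`, `Wcx_eq_hol_loop`), `B7Prop3Flat` (`expCfg`,
`val_bavg`), `B7Eq78Linearization` (`conjR`, calculus §), and — the one cross-lineage import — `B12AverageCorridor267`
(b12 gen 21) for the FRÉCHET DERIVATIVES of the series logarithm and of the exponential at general points: `Dmlog W`,
`hasFDerivAt_mlog` (`‖W − 1‖ < 1`), `Dexp Y`, `hasFDerivAt_exp_Dexp`, `PhiY Y = (· e^{−Y}) ∘ (D exp)_Y` — print's operators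
`g⁻¹(∓i ad_{Y_x})`, `g(−i ad_Y)` of (116)–(119) are these up to the factors `i`.

THE PRINTED TEXT (verbatim from the renders).  p. 34 (113): "(Ṽ₁)_c = (\overline{V₁V₀})_c(V̄₀)_c⁻¹ = exp[i Σ_{x∈B(c₋)} L^{−d}
(1/i) log(V₁V₀)(Γ_{c,x}∪(−c))]·(V₁V₀)(c)V₀(c)⁻¹ exp[−i Σ_{x∈B(c₋)} L^{−d} (1/i) log V₀(Γ_{c,x}∪(−c))] = exp[i Σ_{x∈B(c₋)}
L^{−d} (1/i) log(R_{0,c₋}V₁)(Γ_{c,x}∪(−c))V₀(Γ_{c,x}∪(−c))]·(R_{0,c₋}V₁)(c) exp[−i Σ_{x∈B(c₋)} L^{−d} (1/i) log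
V₀(Γ_{c,x}∪(−c))],"; (114): "A_x = (1/i) log(R_{0,c₋}V₁)(Γ_{c,x}∪(−c)), Y_x = (1/i) log V₀(Γ_{c,x}∪(−c))."; (115): "A_x =
(R_{0,c₋}A)(Γ_{c,x}∪(−c)) + O(L²α₁²) = (R_{0,c₋}A)(Γ_{c₋,x}∪[x, x′]) − R(e^{iY_x})(R_{0,c₋}A)(c∪Γ_{c₊,x′}) + O(L²α₁²)."
p. 35 (116): "(1/i) log e^{iA_x}e^{iY_x} = Y_x + g⁻¹(−i ad_{Y_x})A_x + O(|A_x|²)."; (117): "(Ṽ₁)_c = exp[i Σ_{x∈B(c₋)} L^{−d}Y_x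
+ i Σ_{x∈B(c₋)} L^{−d}g⁻¹(−i ad_{Y_x})A_x + O(L²α₁²)] · exp[i(R_{0,c₋}A)(c) + O(L²α₁²)] exp[−i Σ_{x∈B(c₋)} L^{−d}Y_x]."; "Denoting
Σ_{x∈B(c₋)} L^{−d}Y_x = Y and using the formula (41), we have further (Ṽ₁)_c = … = exp[(Q′(V₀)A)_c + O(L²α₁²)], (118) where
(Q′(V₀)A)_c = g(−i ad_Y) Σ_{x∈B(c₋)} L^{−d}g⁻¹(−i ad_{Y_x})·[(R_{0,c₋}A)(Γ_{c₋,x}∪[x, x′]) − R(e^{iY_x})(R_{0,c₋}A)(c∪Γ_{c₊,x′})]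
+ R(e^{iY})(R_{0,c₋}A)(c), (119) as it follows from (115)."; (120) as quoted in `B7Prop3GeneralLinear`; p. 36 (121)–(122)
idem ("its Taylor expansion begins with a first-order polynomial. Let us denote it by L(Q(V₀)A)_c").

DICTIONARY print ↦ Lean (b07 conventions; the `i`'s absorbed: `iA ↦ A`, `iY_x ↦ log W_x(V₀) = mlog (Wcx L V₀ q κ r)`,
`iY ↦ X₀ := Xavg L V₀ q κ`).  `A_x` to first order, `(R_{0,c₋}A)(Γ_{c,x}∪(−c))` ↦ **`Aloop L V₀ A q κ r := tsum V₀ A q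
(gammaWord L κ r ++ seg κ (−L))`**; `g⁻¹(−i ad_{Y_x})A_x` ↦ `Dmlog (W_x) (A_x^{(1)}·W_x)` (the derivative of `log` at `W_x`
applied to the velocity `A_x^{(1)}W_x` of the loop); the first exponent's first-order term `Σ_x L^{−d}g⁻¹(−i ad_{Y_x})A_x` ↦
**`DXavg`**; `g(−i ad_Y)Z` ↦ `PhiY X₀ Z = (D exp)_{X₀}(Z)·e^{−X₀}`; `R(e^{iY})` ↦ `conjR (expUnit X₀)`; `(R_{0,c₋}A)(c)` ↦
`tsum V₀ A q (seg κ L)`; **`(Q′(V₀)A)_c` ↦ `QprimeCov L V₀ A q κ := PhiY X₀ (DXavg) + conjR (expUnit X₀) ((R_{0,c₋}A)(c))`** —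
(119) in the form it comes out of (113)/(117), i.e. BEFORE print's rearrangement by `R(e^{iY_x}) = e^{i ad_{Y_x}}`,
`g⁻¹(−i ad_{Y_x})e^{i ad_{Y_x}} = g⁻¹(i ad_{Y_x})` and (115) (that rearrangement, leading to (124), is the sequel's).

WHAT THIS FILE PROVES (kernel, no `sorry`, standard axioms; the ONLY hypothesis is the small-field condition
`‖W_x(V₀) − 1‖ < 1` on the block `B(c₋)` — the convergence disc of (21) —, which (109) implies via Prop. 1):
* §1 `tsum_add`, `tsum_smul` — `(R_{0,y}A)(Γ)` is `ℂ`-linear in `A`.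
* §2 `hasDerivAt_Wcx_expCfg` (the loop of `e^{tA}V₀` has velocity `A_x^{(1)}·W_x(V₀)` at `0`), **`hasDerivAt_mlog_Wcx_expCfg`**
  ((116) to first order: `d/dt|₀ log W_x(e^{tA}V₀) = Dmlog (W_x) (A_x^{(1)}W_x)`), `hasDerivAt_Xavg_expCfg` (the exponent
  `X_c`).
* §3 `val_tild_expCfg` ((113): `Ṽ₁(c)[e^{tA}V₀] = e^{X_c(e^{tA}V₀)}·(R_{0,c₋}e^{tA})(c)·e^{−X_c(V₀)}`), **`hasDerivAt_tild_expCfg`**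
  (`d/dt|₀ Ṽ₁(c) = (Q′(V₀)A)_c` = `QprimeCov`).
* §4 **`hasDerivAt_Qcov`**/**`linQcov_eq`** — (120) differentiated: «L(Q(V₀)A)_c» `= −F̂_{V₀}(c₋) + (Q′(V₀)A)_c +
  R̄_{0,c}F̂_{V₀}(c₊)` in closed form; `FhatCov_add/_smul`, `DXavg_smul`, `QprimeCov_add/_smul`, and **`linQcov_add`**,
  **`linQcov_smul`** — the derivative-defined linear part of (122) IS additive and `ℂ`-homogeneous in `A`; `loops_flat`
  (the hypothesis holds at `V₀ = 1`).
ABSOLUTE-RULE LEDGER.  No `B7.Prop*` placeholder, no Literature `Prop`-fact, nothing of the manuscript cited as a fact;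
definitions `Aloop`, `DXavg`, `QprimeCov` over the lineage's objects; the small-field hypothesis is displayed.
NOT CERTIFIED HERE (located; the row's remaining work).  (i) print's rearranged form (119)/(124) of `(Q′(V₀)A)_c` and of
the whole linear part — main term (125) + four `[operator − 1]`-remainders — via (115), `R(e^{iY_x}) = e^{i ad_{Y_x}}` and
p. 35's `(R_{0,c₋}A)(Γ_{c₊,x′}) = e^{−i ad_Y}R̄_{0,c}(R_{0,c₊}A)(Γ_{c₊,x′})`; (ii) the bound (126) `|(Q(V₀)A)_c| ≤ (1 +
O(1)L²α₀)|A|` (with `B12AverageCorridor267`'s `norm_PsiW_sub_one_le`/`norm_PhiY_sub_one_le`/`norm_AdU_expU_sub_one_le` as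
the «operators … estimated by O(L²α₀)» and (109) ⇒ `|Y_x| = O(L²α₀)` by Prop. 1); (iii) the second-order remainders
`O(L²α₁²)`/`O(|A_x|²)` of (115)–(118), analyticity, (123) (rows S55-analytic/S58).
DIVERGENCES from print (cell DIVERGENCE.md).  (a) every `O(·)` statement of (113)–(120) is rendered as an exact
derivative at `t = 0` along the complex ray `V₁ = e^{tA}`; (b) `(Q′(V₀)A)_c` in the un-rearranged form (above); (c) setting
and `log` as in the lineage; the one hypothesis is `‖W_x(V₀) − 1‖ < 1` (print: (109) with `α₀ ≤ c₃`).
VALUE.  The linear part of Prop. 3 at a curved background in closed form for the paper's own (89), and its linearity —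
the content of «L(Q(V₀)A)_c» in (122) — kernel-certified; NOT summit progress (NE7c NOT PROVED; spine PROVED 0∕9; rung
(B)+1 on a finite T⁴ — NOT infinite volume, NOT mass gap, NOT Clay).
-/

noncomputable section

open scoped BigOperators
open NormedSpace Finset

namespace Literature.MathematicalPhysics.QuantumFieldTheory.Balaban1983to89.B7Prop3GeneralTild

open B7Prop1Explicit B7Prop3Flat B7Eq92Concrete MatrixLog B7Prop3GeneralRotated B7Prop3GeneralLinear
open B7Eq78Linearization (conjR conjR_apply conjR_add conjR_smul conjR_one hasDerivAt_mlog_comp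
  hasDerivAt_conjR_comp)
open B12AverageCorridor267 (Dmlog Dexp hasFDerivAt_mlog hasFDerivAt_exp_Dexp PhiY PhiY_apply)
open B8Ineq130 (hol_one)

-- `Site` alone would resolve to the torus sites of `Setup.lean`; re-export the `ℤ^d` sites of `B7Prop1Explicit`.
export B7Prop1Explicit (Site)

variable {d : ℕ}

variable {𝔸 : Type*} [NormedRing 𝔸] [NormedAlgebra ℂ 𝔸] [NormOneClass 𝔸] [CompleteSpace 𝔸]
variable (L : ℕ)

/-! ## §1 Linearity of the rotated functional `(R_{0,y}A)(Γ)` in `A` -/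

section Linear

omit [NormedAlgebra ℂ 𝔸] [NormOneClass 𝔸] [CompleteSpace 𝔸] in
/-- `(R_{0,y}(A+A′))(Γ) = (R_{0,y}A)(Γ) + (R_{0,y}A′)(Γ)` — "a first-order polynomial": the sum replacing the product (58) is
additive in `A`. [cite: Balaban1985Averaging, p.28, (122) p.36] -/
theorem tsum_add (V₀ : Site d → Fin d → 𝔸ˣ) (A A' : Site d → Fin d → 𝔸) :
    ∀ (x : Site d) (w : List (Letter d)), tsum V₀ (A + A') x w = tsum V₀ A x w + tsum V₀ A' x w
  | x, [] => by simp
  | x, l :: w => by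
    rw [tsum_cons, tsum_cons, tsum_cons, tsum_add V₀ A A' (x + l.vec) w, conjR_add]
    have : tstep V₀ (A + A') x l = tstep V₀ A x l + tstep V₀ A' x l := by
      unfold tstep
      split_ifs <;> simp [conjR_add, Pi.add_apply, add_comm]
    rw [this]
    abel

omit [NormOneClass 𝔸] [CompleteSpace 𝔸] in
/-- `(R_{0,y}(cA))(Γ) = c·(R_{0,y}A)(Γ)` for complex `c` — homogeneity of the first-order term. [cite: Balaban1985Averaging, p.28, (122) p.36] -/
theorem tsum_smul (V₀ : Site d → Fin d → 𝔸ˣ) (c : ℂ) (A : Site d → Fin d → 𝔸) :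
    ∀ (x : Site d) (w : List (Letter d)), tsum V₀ (c • A) x w = c • tsum V₀ A x w
  | x, [] => by simp
  | x, l :: w => by
    rw [tsum_cons, tsum_cons, tsum_smul V₀ c A (x + l.vec) w, conjR_smul, smul_add]
    have : tstep V₀ (c • A) x l = c • tstep V₀ A x l := by
      unfold tstep
      split_ifs <;> simp [conjR_smul, smul_neg]
    rw [this]

end Linear

/-! ## §2 The block loops `V(Γ_{c,x} ∪ (−c))` along the ray `V₁ = e^{tA}`: (114)–(116) to first order -/

section Loops

omit [NormedAlgebra ℂ 𝔸] [NormOneClass 𝔸] [CompleteSpace 𝔸] in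
/-- **(114)/(115) to first order**: `A_x = (1/i) log(R_{0,c₋}V₁)(Γ_{c,x}∪(−c)) = (R_{0,c₋}A)(Γ_{c,x}∪(−c)) + O(L²α₁²)` — the
first-order term, the rotated functional along the CLOSED contour `Γ_{c,x} ∪ (−c)` of (42) (`gammaWord ++ seg κ (−L)`,
`B7Prop1Explicit.Wcx_eq_hol_loop`), for the `L`-bond `c = ⟨q, q + Le_κ⟩` and `x = q + r`. [cite: Balaban1985Averaging, (114)–(115) p.34] -/
def Aloop (V₀ : Site d → Fin d → 𝔸ˣ) (A : Site d → Fin d → 𝔸) (q : Site d) (κ : Fin d) (r : Site d) : 𝔸 :=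
  tsum V₀ A q (gammaWord L κ r ++ seg κ (-(L : ℤ)))

omit [NormOneClass 𝔸] in
/-- the loop holonomy `W_x = V(Γ_{c,x}∪(−c))` of `V = e^{tA}V₀` has `t`-derivative `A_x^{(1)}·W_x(V₀)` at `0`,
`A_x^{(1)} = (R_{0,c₋}A)(Γ_{c,x}∪(−c))` ((114) linearised; `B7Prop3GeneralRotated.hasDerivAt_hol_expCfg_mul`).
[cite: Balaban1985Averaging, (113)–(115) p.34] -/
theorem hasDerivAt_Wcx_expCfg (V₀ : Site d → Fin d → 𝔸ˣ) (A : Site d → Fin d → 𝔸) (q : Site d) (κ : Fin d)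
    (r : Site d) :
    HasDerivAt (fun t : ℂ => ((Wcx L (expCfg (t • A) * V₀) q κ r : 𝔸ˣ) : 𝔸))
      (Aloop L V₀ A q κ r * ((Wcx L V₀ q κ r : 𝔸ˣ) : 𝔸)) 0 := by
  simp only [Wcx_eq_hol_loop]
  exact hasDerivAt_hol_expCfg_mul V₀ A q _

omit [NormOneClass 𝔸] in
/-- **(116) to first order**: "(1/i) log e^{iA_x}e^{iY_x} = Y_x + g⁻¹(−i ad_{Y_x})A_x + O(|A_x|²)" — the `t`-derivative at
`0` of `log W_x(e^{tA}V₀)` is `(D log)_{W_x(V₀)}(A_x^{(1)}·W_x(V₀))` (the Fréchet derivative of the series (21) at the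
background loop, `B12AverageCorridor267.Dmlog`/`hasFDerivAt_mlog` BY NAME; this operator is print's `g⁻¹(−i ad_{Y_x})`
up to the `i`'s), under the small-field condition `‖W_x(V₀) − 1‖ < 1` (from (109) by Prop. 1). [cite: Balaban1985Averaging, (116) p.35, (38) p.22] -/
theorem hasDerivAt_mlog_Wcx_expCfg (V₀ : Site d → Fin d → 𝔸ˣ) (A : Site d → Fin d → 𝔸) (q : Site d) (κ : Fin d)
    (r : Site d) (hW : ‖((Wcx L V₀ q κ r : 𝔸ˣ) : 𝔸) - 1‖ < 1) :
    HasDerivAt (fun t : ℂ => mlog ((Wcx L (expCfg (t • A) * V₀) q κ r : 𝔸ˣ) : 𝔸))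
      (Dmlog ((Wcx L V₀ q κ r : 𝔸ˣ) : 𝔸) (Aloop L V₀ A q κ r * ((Wcx L V₀ q κ r : 𝔸ˣ) : 𝔸))) 0 :=
  (hasFDerivAt_mlog hW).comp_hasDerivAt_of_eq 0 (hasDerivAt_Wcx_expCfg L V₀ A q κ r)
    (by rw [expCfg_zero_smul_mul])

/-- **the first exponent of (117), to first order**: the `t`-derivative at `0` of the exponent
`X_c = Σ_{x∈B(c₋)} L^{−d} log W_x` of the average (42) of `e^{tA}V₀` is `Σ_x L^{−d} (D log)_{W_x(V₀)}(A_x^{(1)}·W_x(V₀))`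
("i Σ_{x∈B(c₋)} L^{−d} g⁻¹(−i ad_{Y_x})A_x" in (117)). [cite: Balaban1985Averaging, (117) p.35] -/
def DXavg (V₀ : Site d → Fin d → 𝔸ˣ) (A : Site d → Fin d → 𝔸) (q : Site d) (κ : Fin d) : 𝔸 :=
  ∑ r : Fin d → Fin L, (((L : ℝ) ^ d)⁻¹) •
    Dmlog ((Wcx L V₀ q κ (boxVec L r) : 𝔸ˣ) : 𝔸)
      (Aloop L V₀ A q κ (boxVec L r) * ((Wcx L V₀ q κ (boxVec L r) : 𝔸ˣ) : 𝔸))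

omit [NormOneClass 𝔸] in
/-- the exponent `X_c` of (42) for `e^{tA}V₀` has `t`-derivative `DXavg` at `0`, under `‖W_x(V₀) − 1‖ < 1` on the block.
[cite: Balaban1985Averaging, (117) p.35, (42) p.23] -/
theorem hasDerivAt_Xavg_expCfg (V₀ : Site d → Fin d → 𝔸ˣ) (A : Site d → Fin d → 𝔸) (q : Site d) (κ : Fin d)
    (hW : ∀ r : Fin d → Fin L, ‖((Wcx L V₀ q κ (boxVec L r) : 𝔸ˣ) : 𝔸) - 1‖ < 1) :
    HasDerivAt (fun t : ℂ => Xavg L (expCfg (t • A) * V₀) q κ) (DXavg L V₀ A q κ) 0 := by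
  unfold Xavg DXavg
  refine HasDerivAt.fun_sum fun r _ => ?_
  exact (hasDerivAt_mlog_Wcx_expCfg L V₀ A q κ (boxVec L r) (hW r)).const_smul (((L : ℝ) ^ d)⁻¹)

end Loops

/-! ## §3 The derivative of `Ṽ₁(c)` — (113), (117)–(119): print's `(Q′(V₀)A)_c` -/

section Tild

/-- **(119) `(Q′(V₀)A)_c`**, the first-order term of `(1/i) log Ṽ₁(c)` ((118) "= exp[(Q′(V₀)A)_c + O(L²α₁²)]"), in the
form it comes out of (113)/(117) BEFORE print's rearrangement by the identities `R(e^{iY_x}) = e^{i ad_{Y_x}}`,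
`g⁻¹(−i ad_{Y_x})e^{i ad_{Y_x}} = g⁻¹(i ad_{Y_x})` and (115): `g(−i ad_Y)[Σ_x L^{−d} g⁻¹(−i ad_{Y_x})A_x^{(1)}] + R(e^{iY})(R_{0,c₋}A)(c)`
— here `g(−i ad_Y)Z` ↦ `(D exp)_{X₀}(Z)·e^{−X₀}` (`B12AverageCorridor267.PhiY`, `X₀ = iY =` the exponent `X_c(V₀)` of (42)),
the inner sum ↦ `DXavg`, `R(e^{iY})` ↦ `conjR (expUnit X₀)`, `(R_{0,c₋}A)(c)` ↦ `tsum V₀ A q (seg κ L)`.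
[cite: Balaban1985Averaging, (119) p.35, (117)–(118) p.35] -/
def QprimeCov (V₀ : Site d → Fin d → 𝔸ˣ) (A : Site d → Fin d → 𝔸) (q : Site d) (κ : Fin d) : 𝔸 :=
  PhiY (Xavg L V₀ q κ) (DXavg L V₀ A q κ) + conjR (expUnit (Xavg L V₀ q κ)) (tsum V₀ A q (seg κ L))

omit [NormOneClass 𝔸] in
/-- **(113) as a formula for `Ṽ₁(c)` along the ray**: `Ṽ₁(c)[e^{tA}V₀] = exp(X_c(e^{tA}V₀)) · (R_{0,c₋}e^{tA})(c) · exp(−X_c(V₀))`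
("(Ṽ₁)_c = exp[i Σ L^{−d}(1/i) log(V₁V₀)(Γ_{c,x}∪(−c))]·(V₁V₀)(c)V₀(c)⁻¹·exp[−i Σ L^{−d}(1/i) log V₀(Γ_{c,x}∪(−c))]").
[cite: Balaban1985Averaging, (113) p.34] -/
theorem val_tild_expCfg (V₀ : Site d → Fin d → 𝔸ˣ) (A : Site d → Fin d → 𝔸) (q : Site d) (κ : Fin d) (t : ℂ) :
    ((tild L V₀ (expCfg (t • A)) q κ : 𝔸ˣ) : 𝔸)
      = exp (Xavg L (expCfg (t • A) * V₀) q κ) * ((tHol V₀ (expCfg (t • A)) q (seg κ L) : 𝔸ˣ) : 𝔸)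
        * exp (-Xavg L V₀ q κ) := by
  rw [tild_apply, tHol, Units.val_mul, Units.val_mul, val_bavg]
  have hinv : (((bavg L V₀ q κ)⁻¹ : 𝔸ˣ) : 𝔸)
      = (((hol V₀ q (seg κ L))⁻¹ : 𝔸ˣ) : 𝔸) * exp (-Xavg L V₀ q κ) := by
    rw [show bavg L V₀ q κ = expUnit (Xavg L V₀ q κ) * hol V₀ q (seg κ L) from rfl, mul_inv_rev, Units.val_mul,
      val_inv_expUnit, val_expUnit]
  rw [hinv]
  simp only [mul_assoc]

/-- **THE DERIVATIVE OF `Ṽ₁(c)`** along `V₁ = e^{tA}` at `t = 0` is `(Q′(V₀)A)_c` in the form `QprimeCov` — (113)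
differentiated: `(D exp)_{X₀}(ΣL^{−d}(D log)_{W_x}(A_x^{(1)}W_x))·e^{−X₀} + e^{X₀}(R_{0,c₋}A)(c)e^{−X₀}` (the middle factor
`(R_{0,c₋}e^{tA})(c)` passes through `1` with derivative `(R_{0,c₋}A)(c)`), under `‖W_x(V₀) − 1‖ < 1` on `B(c₋)`.
[cite: Balaban1985Averaging, (117)–(119) p.35, (113) p.34] -/
theorem hasDerivAt_tild_expCfg (V₀ : Site d → Fin d → 𝔸ˣ) (A : Site d → Fin d → 𝔸) (q : Site d) (κ : Fin d)
    (hW : ∀ r : Fin d → Fin L, ‖((Wcx L V₀ q κ (boxVec L r) : 𝔸ˣ) : 𝔸) - 1‖ < 1) :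
    HasDerivAt (fun t : ℂ => ((tild L V₀ (expCfg (t • A)) q κ : 𝔸ˣ) : 𝔸)) (QprimeCov L V₀ A q κ) 0 := by
  have hX := hasDerivAt_Xavg_expCfg L V₀ A q κ hW
  have h1 : HasDerivAt (fun t : ℂ => exp (Xavg L (expCfg (t • A) * V₀) q κ))
      (Dexp (Xavg L V₀ q κ) (DXavg L V₀ A q κ)) 0 :=
    (hasFDerivAt_exp_Dexp (Xavg L V₀ q κ)).comp_hasDerivAt_of_eq 0 hX (by rw [expCfg_zero_smul_mul])
  have h2 := hasDerivAt_tHol_expCfg V₀ A q (seg κ L)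
  have h := (h1.fun_mul h2).mul_const (exp (-Xavg L V₀ q κ))
  simp only [expCfg_zero_smul_mul, tHol_expCfg_zero_smul, Units.val_one, mul_one] at h
  simp_rw [val_tild_expCfg]
  refine h.congr_deriv ?_
  rw [QprimeCov, PhiY_apply, conjR_apply, val_inv_expUnit, val_expUnit, val_expUnit, add_mul]

end Tild

/-! ## §4 (120): the linear part «L(Q(V₀)A)_c» in closed form (before the regrouping (124)), and its linearity -/

section Assembly

/-- **(120) DIFFERENTIATED — THE LINEAR PART IN CLOSED FORM**: under `‖W_x(V₀) − 1‖ < 1` on `B(c₋)`, `t ↦ Q(V₀, tA, c)` has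
`t`-derivative `−F̂_{V₀}(c₋) + (Q′(V₀)A)_c + R̄_{0,c}F̂_{V₀}(c₊)` at `0` — the three first-order terms of the exponent of
(120) "−i Σ_{x∈B(c₋)} L^{−d}(R_{0,c₋}A)(Γ_{c₋,x}) + i(Q′(V₀)A)_c + i Σ_{x′∈B(c₊)} L^{−d} R̄_{0,c}(R_{0,c₊}A)(Γ_{c₊,x′})"
(`B7Prop3GeneralLinear.hasDerivAt_Qcov_of_tild` with `D := QprimeCov` from §3). [cite: Balaban1985Averaging, (120) p.35, (122) p.36] -/
theorem hasDerivAt_Qcov (V₀ : Site d → Fin d → 𝔸ˣ) (A : Site d → Fin d → 𝔸) (q : Site d) (κ : Fin d)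
    (hW : ∀ r : Fin d → Fin L, ‖((Wcx L V₀ q κ (boxVec L r) : 𝔸ˣ) : 𝔸) - 1‖ < 1) :
    HasDerivAt (fun t : ℂ => Qcov L V₀ (t • A) q κ)
      (-FhatCov L V₀ A q + QprimeCov L V₀ A q κ + conjR (bavg L V₀ q κ) (FhatCov L V₀ A (q + (L : ℤ) • e κ))) 0 :=
  hasDerivAt_Qcov_of_tild L V₀ A q κ (hasDerivAt_tild_expCfg L V₀ A q κ hW)

/-- **«L(Q(V₀)A)_c» IN CLOSED FORM** ((120) ⇒ (122)): `linQcov = −F̂_{V₀}(c₋) + (Q′(V₀)A)_c + R̄_{0,c}F̂_{V₀}(c₊)`, under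
`‖W_x(V₀) − 1‖ < 1` on `B(c₋)`. The regrouping into (124) (main term (125) + four `[operator − 1]`-remainders) and the
bound (126) are the sequel's. [cite: Balaban1985Averaging, (120) p.35, (122) p.36, (124) p.36] -/
theorem linQcov_eq (V₀ : Site d → Fin d → 𝔸ˣ) (A : Site d → Fin d → 𝔸) (q : Site d) (κ : Fin d)
    (hW : ∀ r : Fin d → Fin L, ‖((Wcx L V₀ q κ (boxVec L r) : 𝔸ˣ) : 𝔸) - 1‖ < 1) :
    linQcov L V₀ A q κ
      = -FhatCov L V₀ A q + QprimeCov L V₀ A q κ + conjR (bavg L V₀ q κ) (FhatCov L V₀ A (q + (L : ℤ) • e κ)) :=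
  (hasDerivAt_Qcov L V₀ A q κ hW).deriv

omit [NormedAlgebra ℂ 𝔸] [NormOneClass 𝔸] [CompleteSpace 𝔸] in
/-- `F̂_{V₀}` is additive in `A`. [cite: Balaban1985Averaging, (112) p.34, (122) p.36] -/
theorem FhatCov_add [NormedAlgebra ℂ 𝔸] (V₀ : Site d → Fin d → 𝔸ˣ) (A A' : Site d → Fin d → 𝔸) (y : Site d) :
    FhatCov L V₀ (A + A') y = FhatCov L V₀ A y + FhatCov L V₀ A' y := by
  simp [FhatCov, tsum_add, smul_add, Finset.sum_add_distrib]

omit [NormOneClass 𝔸] [CompleteSpace 𝔸] in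
/-- `F̂_{V₀}` is `ℂ`-homogeneous in `A`. [cite: Balaban1985Averaging, (112) p.34, (122) p.36] -/
theorem FhatCov_smul (V₀ : Site d → Fin d → 𝔸ˣ) (c : ℂ) (A : Site d → Fin d → 𝔸) (y : Site d) :
    FhatCov L V₀ (c • A) y = c • FhatCov L V₀ A y := by
  simp [FhatCov, tsum_smul, Finset.smul_sum, smul_comm c]

omit [NormOneClass 𝔸] in
/-- `(Q′(V₀)·)_c` is additive in `A` (every operator in (119) is linear). [cite: Balaban1985Averaging, (119) p.35, (122) p.36] -/
theorem QprimeCov_add (V₀ : Site d → Fin d → 𝔸ˣ) (A A' : Site d → Fin d → 𝔸) (q : Site d) (κ : Fin d) :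
    QprimeCov L V₀ (A + A') q κ = QprimeCov L V₀ A q κ + QprimeCov L V₀ A' q κ := by
  simp only [QprimeCov, DXavg, Aloop, tsum_add, add_mul, map_add, smul_add, Finset.sum_add_distrib, conjR_add]
  abel

omit [NormOneClass 𝔸] [CompleteSpace 𝔸] in
/-- `DXavg` is `ℂ`-homogeneous in `A`. [cite: Balaban1985Averaging, (117) p.35, (122) p.36] -/
theorem DXavg_smul (V₀ : Site d → Fin d → 𝔸ˣ) (c : ℂ) (A : Site d → Fin d → 𝔸) (q : Site d) (κ : Fin d) :
    DXavg L V₀ (c • A) q κ = c • DXavg L V₀ A q κ := by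
  simp only [DXavg, Aloop, tsum_smul, smul_mul_assoc, map_smul, Finset.smul_sum]
  exact Finset.sum_congr rfl fun r _ => smul_comm _ _ _

omit [NormOneClass 𝔸] in
/-- `(Q′(V₀)·)_c` is `ℂ`-homogeneous in `A`. [cite: Balaban1985Averaging, (119) p.35, (122) p.36] -/
theorem QprimeCov_smul (V₀ : Site d → Fin d → 𝔸ˣ) (c : ℂ) (A : Site d → Fin d → 𝔸) (q : Site d) (κ : Fin d) :
    QprimeCov L V₀ (c • A) q κ = c • QprimeCov L V₀ A q κ := by
  rw [QprimeCov, QprimeCov, DXavg_smul, map_smul, tsum_smul, conjR_smul, smul_add]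

/-- **"its Taylor expansion begins with a first-order polynomial" — THE LINEAR PART IS ADDITIVE IN `A`** (a genuine
content of (122), now a theorem for the derivative-defined «L(Q(V₀)A)_c»), under `‖W_x(V₀) − 1‖ < 1` on `B(c₋)`.
[cite: Balaban1985Averaging, (122) p.36] -/
theorem linQcov_add (V₀ : Site d → Fin d → 𝔸ˣ) (A A' : Site d → Fin d → 𝔸) (q : Site d) (κ : Fin d)
    (hW : ∀ r : Fin d → Fin L, ‖((Wcx L V₀ q κ (boxVec L r) : 𝔸ˣ) : 𝔸) - 1‖ < 1) :
    linQcov L V₀ (A + A') q κ = linQcov L V₀ A q κ + linQcov L V₀ A' q κ := by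
  rw [linQcov_eq L V₀ _ q κ hW, linQcov_eq L V₀ A q κ hW, linQcov_eq L V₀ A' q κ hW, FhatCov_add, FhatCov_add,
    QprimeCov_add, conjR_add, neg_add]
  abel

/-- … and `ℂ`-HOMOGENEOUS in `A`. [cite: Balaban1985Averaging, (122) p.36] -/
theorem linQcov_smul (V₀ : Site d → Fin d → 𝔸ˣ) (c : ℂ) (A : Site d → Fin d → 𝔸) (q : Site d) (κ : Fin d)
    (hW : ∀ r : Fin d → Fin L, ‖((Wcx L V₀ q κ (boxVec L r) : 𝔸ˣ) : 𝔸) - 1‖ < 1) :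
    linQcov L V₀ (c • A) q κ = c • linQcov L V₀ A q κ := by
  rw [linQcov_eq L V₀ _ q κ hW, linQcov_eq L V₀ A q κ hW, FhatCov_smul, FhatCov_smul, QprimeCov_smul, conjR_smul,
    smul_add, smul_add, smul_neg]

omit [NormedAlgebra ℂ 𝔸] [NormOneClass 𝔸] [CompleteSpace 𝔸] in
/-- flat sanity: at `V₀ = 1` every loop is `1`, `X₀ = 0`, `D log = D exp = id`, and the closed form collapses to
`B7Prop3Flat`'s `−F̂(c₋) + T_c + F̂(c₊) = L·(Q₀A)_c` (`frame_cancellation`) — here recorded as the statement that the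
hypothesis of `linQcov_eq` holds trivially at the flat background. [cite: Balaban1985Averaging, (120) p.35, (125) p.36] -/
theorem loops_flat (q : Site d) (κ : Fin d) (r : Fin d → Fin L) :
    ‖((Wcx L (1 : Site d → Fin d → 𝔸ˣ) q κ (boxVec L r) : 𝔸ˣ) : 𝔸) - 1‖ < 1 := by
  rw [Wcx_eq_hol_loop, hol_one, Units.val_one, sub_self, norm_zero]
  exact one_pos

end Assembly

end Literature.MathematicalPhysics.QuantumFieldTheory.Balaban1983to89.B7Prop3GeneralTild

end
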